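import Summits.RiemannHypothesis.RiemannHypothesis.Theorems.SpectralTraceHeckeSurrogateDefs
import Literature.Uncategorized.GammaLowerBound
import Literature.NumberTheory.LFunctions.RiemannXi
import Literature.NumberTheory.LFunctions.RiemannXiOrderProofs
import Mathlib.NumberTheory.LSeries.RiemannZeta
import HarnessLib

/-!
# `ξ₂ = 2ξ` is a window-invisible surrogate — stub `stub_xi2Surrogate`

Route `RiemannHypothesis/SpectralTrace`, crux `WindowTracePrime2` (stmt-RiemannHypothesis-11196),
line `hecke-cusp-perturbation-surrogate`, registered stub **5a** `stub_xi2Surrogate : IsSurrogate xi2`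
(skeleton `Cruxes/WindowTracePrime2/Lines/hecke_cusp_perturbation_surrogate.lean`; vocabulary
`Theorems/SpectralTraceHeckeSurrogateDefs.lean`).

`ξ₂(s) := 2ξ(s) = s(s-1) π^{-s/2} Γ(s/2) ζ(s)` is the degenerate member (zero cusp datum) of the
surrogate class `IsSurrogate`: it is entire (`differentiable_riemannXi`), of order `≤ 1` in
Titchmarsh's quantitative form (the PROVED tree fact `riemannXi_order_le_one_holds`, constant doubled),
satisfies `ξ₂(1-s) = ξ₂(s)` (`riemannXi_one_sub`), and on `Re s > 2` it is
`s(s-1) Γ_ℝ(s) Σ_{k ≥ 0} (k+1)^{-s}` (`riemannXi_eq_mul_completedRiemannZeta`, Mathlib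
`riemannZeta_def_of_ne_zero`, `zeta_eq_tsum_one_div_nat_add_one_cpow`), i.e. the Dirichlet data
`c_k = 1`, `ν_k = k + 1`, `σ₀ = 2` (`Σ (k+1)^{-2} < ∞`).

References: E. C. Titchmarsh, *The theory of the Riemann zeta-function* (1986), §2.1 eq. (2.1.12),
(2.1.13), §2.12 Thm. 2.12 [Titchmarsh1986]; E. Hecke, *Über die Bestimmung Dirichletscher Reihen durch
ihre Funktionalgleichung*, Math. Ann. 112 (1936), §2 [Hecke1936].
-/

noncomputable section

set_option linter.dupNamespace false

namespace Summit.RiemannHypothesis.RiemannHypothesis.Theorems.HeckeSurrogate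

open Complex Filter Set MeasureTheory
open scoped Real Topology
open Literature.NumberTheory.LFunctions
open Literature.Uncategorized

/-! ## The four conjuncts of `IsSurrogate xi2` -/

/-- `ξ₂ = 2ξ` is entire (Titchmarsh §2.1). [cite: Titchmarsh1986, §2.1 eq. (2.1.12)] -/
theorem differentiable_xi2 : Differentiable ℂ xi2 :=
  (differentiable_const (2 : ℂ)).mul differentiable_riemannXi

/-- `ξ₂` has order at most `1`, quantitatively: `‖ξ₂(s)‖ ≤ C exp(A‖s‖ log(1+‖s‖))` (Titchmarsh
Thm. 2.12, eq. (2.12.3), via the proved tree fact `riemannXi_order_le_one_holds` with the constant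
doubled). [cite: Titchmarsh1986, Thm. 2.12 eq. (2.12.3)] -/
theorem xi2_order_le_one :
    ∃ A C : ℝ, ∀ s : ℂ, ‖xi2 s‖ ≤ C * Real.exp (A * ‖s‖ * Real.log (1 + ‖s‖)) := by
  obtain ⟨A, C, hAC⟩ := riemannXi_order_le_one_holds
  refine ⟨A, 2 * C, fun s => ?_⟩
  have h2 : ‖xi2 s‖ = 2 * ‖riemannXi s‖ := by
    rw [xi2, norm_mul, Complex.norm_two]
  rw [h2, mul_assoc]
  exact mul_le_mul_of_nonneg_left (hAC s) zero_le_two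

/-- The functional equation `ξ₂(1-s) = ξ₂(s)` (Titchmarsh eq. (2.1.13)).
[cite: Titchmarsh1986, §2.1 eq. (2.1.13)] -/
theorem xi2_one_sub (s : ℂ) : xi2 (1 - s) = xi2 s := by
  rw [xi2, xi2, riemannXi_one_sub]

/-- `Σ_{k ≥ 0} ‖1‖ (k+1)^{-2} < ∞` — absolute convergence of the Dirichlet data of `ξ₂` at `σ₀ = 2`.
[folklore] -/
theorem summable_xi2_coeff :
    Summable (fun k : ℕ => ‖(1 : ℂ)‖ * ((k : ℝ) + 1) ^ (-(2 : ℝ))) := by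
  have h := (summable_nat_add_iff 1).2 (Real.summable_nat_rpow.2 (by norm_num : (-(2 : ℝ)) < -1))
  simpa using h

/-- On `Re s > 2`: `ξ₂(s) = s(s-1) Γ_ℝ(s) Σ_{k ≥ 0} 1 · (k+1)^{-s}` (Titchmarsh §2.1 (2.1.12) and the
Dirichlet series of `ζ`; Mathlib `riemannZeta_def_of_ne_zero`, `zeta_eq_tsum_one_div_nat_add_one_cpow`).
[cite: Titchmarsh1986, §2.1 eq. (2.1.12)] -/
theorem xi2_eq_dirichlet {s : ℂ} (hs : 2 < s.re) :
    xi2 s = s * (s - 1) * s.Gammaℝ * ∑' k : ℕ, (1 : ℂ) * ((((k : ℝ) + 1 : ℝ) : ℂ) ^ (-s)) := by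
  have h0 : s ≠ 0 := fun h => by rw [h, Complex.zero_re] at hs; linarith
  have h1 : s ≠ 1 := fun h => by rw [h, Complex.one_re] at hs; linarith
  have hre : 0 < s.re := by linarith
  have hre1 : 1 < s.re := by linarith
  have hG : Gammaℝ s ≠ 0 := Gammaℝ_ne_zero_of_re_pos hre
  have hΛ : completedRiemannZeta s = Gammaℝ s * riemannZeta s := by
    rw [riemannZeta_def_of_ne_zero h0, mul_div_cancel₀ _ hG]
  have hζ : riemannZeta s = ∑' k : ℕ, (1 : ℂ) * ((((k : ℝ) + 1 : ℝ) : ℂ) ^ (-s)) := by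
    rw [zeta_eq_tsum_one_div_nat_add_one_cpow hre1]
    refine tsum_congr fun k => ?_
    push_cast
    rw [one_mul, cpow_neg, one_div]
  rw [xi2, riemannXi_eq_mul_completedRiemannZeta h0 h1, hΛ, hζ]
  ring

/-! ## The registered stub -/

/-- **`stub_xi2Surrogate`** (registered stub 5a of the line `hecke-cusp-perturbation-surrogate`, crux
stmt-RiemannHypothesis-11196): `ξ₂ = 2ξ` is a window-invisible self-dual degree-one surrogate, with
Dirichlet data `c_k = 1`, `ν_k = k + 1`, `σ₀ = 2`. [folklore] -/
theorem stub_xi2Surrogate : IsSurrogate xi2 := by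
  refine ⟨differentiable_xi2, xi2_order_le_one, xi2_one_sub, fun _ => 1, fun k => (k : ℝ) + 1, 2,
    rfl, by simp, rfl, by norm_num, fun k hk => ?_, summable_xi2_coeff, fun s hs => ?_⟩
  · have hk' : (2 : ℝ) ≤ k := by exact_mod_cast hk
    show (3 : ℝ) ≤ (k : ℝ) + 1
    linarith
  · exact xi2_eq_dirichlet hs

end Summit.RiemannHypothesis.RiemannHypothesis.Theorems.HeckeSurrogate

end
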